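import Summits.QuantumFields.YangMills.Theorems.VirialFluxGapCentralSlotReading
import Summits.QuantumFields.YangMills.Theorems.VirialFluxGapRingPolyInsertion
import Summits.QuantumFields.YangMills.Theorems.VirialFluxGapAnchorSliceAlgebra
import Literature.Geometry.GaugeTheory.SpinorAlgebraFour
import Literature.MathematicalPhysics.QuantumLattice.SU2HaarSmallBall
import HarnessLib

/-!
# Route `VirialFluxGap` (YangMills): THE ZERO-FLUX DEFICIT AND ITS DRIVE ALONG ANY PURE DIRECTION FIELD, READ IN QUATERNION LETTERS —
# the lattice ↔ quaternion bridge under clause (P2) of the central package of ⟨stmt-QuantumFields-24141⟩ `PeriodicSoftness`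

The per-term Euler-defect programme for the drive of the explicit central field (w3 g59: ✓`EulerDefectAlgebra` — ✓`temporal_euler_identity`,
✓`drive_sub_two_eq` — and its companions) is stated in QUATERNION letters: a temporal bond is the word `T = 2 − 2Re(q·q̄′)` with drive
`D = −2Re(q(A − A′)q̄′)`, a seam bond or a plaquette is the four-slot word `T = 2 − 2Re(q₁q₂q̄₃q̄₄)` with drive
`D = −2Re(q₁A₁q₂q̄₃q̄₄ + q₁q₂A₂q̄₃q̄₄ − q₁q₂A₃q̄₃q̄₄ − q₁q₂q̄₃A₄q̄₄)` (`A_j` pure).  The tree's deficit ✓`ringPoly` and insertion formula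
✓`fderiv_ringPoly_apply` are stated in `2×2` MATRIX letters.  This file is the dictionary, once and for all, for an ARBITRARY direction assignment
`Y` with pure quaternion values (`Y v = quatMatrix (y v)`, `Re(y v) = 0`):

* §1 matrix ↔ quaternion letters for one word (✓`Literature.Geometry.GaugeTheory.quatMatrix_star` ∕ `quatMatrix_add`): the three term shapes at `SU(2)` points (`two_sub_re_trace_tb`,
  `two_sub_re_trace_seamWord`, `two_sub_re_trace_plaqWord`) and their insertions (`re_trace_tb_insertion`, `re_trace_seam_insertion`,
  `re_trace_plaq_insertion`) — slot orders: seam bond of the edge `e = (x,k)`: `(q₁,q₂,q₃,q₄) = (q_{2L−1}(e), s(x+k), q₀(e), s(x))`;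
  plaquette `p = (x; k<l)` of slice `j`: `(q_j(x,k), q_j(x+k,l), q_j(x+l,k), q_j(x,l))`;
* §2 ★ `ringDeficit_eq_quat_sums` — `F₀(P) = Σ_{i<2L−1}Σ_e (2 − 2Re(q_{i,e} q̄_{i+1,e})) + Σ_e (2 − 2Re(q₁q₂q̄₃q̄₄)) + Σ_jΣ_p (2 − 2Re(q₁q₂q̄₃q̄₄))`;
* §3 ★★ `frameD_ringPoly_eq_quat_sums` — `frameD Y ringPoly (ringCoord P)` is the matching sum of the `D`-words, VERBATIM in the letters of
  ✓`temporal_euler_identity` ∕ ✓`drive_sub_two_eq`, for every pure `y`;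
* §4 ★★ `centralDrive_eq_quat_sums` — on the central region (slice `0` in comb gauge, `|z_k|², |z₄|² ≤ ½`, signs `±1`) the package drive
  `Σ_va centralCoeff L σ σ₄ va M · frameGrad fixFrameStd M va` of the EXPLICIT central field (✓`centralDrive_eq_frameD`) is that sum with
  `A_v = Im(c̄_v q_v) + (s_v/2)·Im c_v` (w2 g52 ✓`centralDir_slot`: `q_v = slotQuat P v`, anchor `c_v = slotQuat (π_C P) v`, sign `s_v = slotSign σ σ₄ v`).

So F2 ("CentralDriveTerms") is: apply the per-word inequality to each summand (anchor pattern ✓`slotQuat_centralProj_parallel` ∕ `_slice` ∕ `_seam`,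
proximity ✓`norm_slotQuat_sub_centralProj_le`), and F3 is `Finset.sum_le_sum`.

HONEST LABEL: dictionary ∕ bookkeeping (theorems only, 0 `def`, 0 `sorry`, standard axioms); no inequality of the package is proved here; ⟨24141⟩ and
⟨22884⟩ stay OPEN; no stub ∕ crux ∕ rung ∕ summit is closed; the Yang–Mills mass gap is NOT proved; no summit is proved by a line.  Width seat
`ym-line-sfw-p2-w2` g53 (cell ym-idea-1, free hands; own crux ⟨22884⟩ has no free stub), `--supports stmt-QuantumFields-24141`.
References: [cite: arXiv220412737, §2 (2.4) (p. 10)] (left-invariant derivatives on matrix groups); [cite: Luscher1983, §2]; [cite: CosteEtAl1985]; [folklore].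
-/

set_option autoImplicit false

noncomputable section

open scoped Matrix BigOperators Quaternion
open Literature.MathematicalPhysics.QuantumFieldTheory hiding SU2
open Literature.MathematicalPhysics.QuantumLattice

namespace Summit.QuantumFields.YangMills.Theorems.VirialFluxGap.DriveReading

open Summit.QuantumFields.YangMills.Theorems.FemtoTransferGap
open Summit.QuantumFields.YangMills.Theorems.VirialFluxGap.RingDeficit
open Summit.QuantumFields.YangMills.Theorems.VirialFluxGap.FrameDerivative
open Summit.QuantumFields.YangMills.Theorems.VirialFluxGap.FrameHessian
open Summit.QuantumFields.YangMills.Theorems.VirialFluxGap.FixFrame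
open Summit.QuantumFields.YangMills.Theorems.VirialFluxGap.CentralField
open Summit.QuantumFields.YangMills.Theorems.VirialFluxGap.CentralSlotReading
open Summit.QuantumFields.YangMills.Theorems.VirialFluxGap.AnchorSlice (star_eq_neg_of_pure)
open Literature.Geometry.GaugeTheory (quatMatrix_star quatMatrix_add)

variable {L : ℕ} [NeZero L]

/-! ## §1 One word: matrix letters ↔ quaternion letters -/

omit [NeZero L] in
/-- The temporal word at `SU(2)` points: `2 − Re tr(U Vᴴ) = 2 − 2Re(u v̄)`. [folklore] -/
theorem two_sub_re_trace_tb (U V : SU2) :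
    (2 : ℝ) - (((U : Matrix (Fin 2) (Fin 2) ℂ) * (V : Matrix (Fin 2) (Fin 2) ℂ)ᴴ).trace).re = 2 - 2 * (su2Quat U * star (su2Quat V)).re := by
  rw [← quatMatrix_su2Quat U, ← quatMatrix_su2Quat V]
  simp only [← quatMatrix_star, ← quatMatrix_mul, trace_quatMatrix_re]

omit [NeZero L] in
/-- The seam word at `SU(2)` points: `2 − Re tr(A (B C Dᴴ)ᴴ) = 2 − 2Re(a d c̄ b̄)` (slots `(q₁,q₂,q₃,q₄) = (a, d, c, b)`). [folklore] -/
theorem two_sub_re_trace_seamWord (A B C D : SU2) :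
    (2 : ℝ) - (((A : Matrix (Fin 2) (Fin 2) ℂ) * ((B : Matrix (Fin 2) (Fin 2) ℂ) * (C : Matrix (Fin 2) (Fin 2) ℂ) * (D : Matrix (Fin 2) (Fin 2) ℂ)ᴴ)ᴴ).trace).re =
      2 - 2 * (su2Quat A * su2Quat D * star (su2Quat C) * star (su2Quat B)).re := by
  rw [← quatMatrix_su2Quat A, ← quatMatrix_su2Quat B, ← quatMatrix_su2Quat C, ← quatMatrix_su2Quat D]
  simp only [← quatMatrix_star, ← quatMatrix_mul, trace_quatMatrix_re, star_mul, star_star, ← mul_assoc]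

omit [NeZero L] in
/-- The plaquette word at `SU(2)` points: `2 − Re tr(A B Cᴴ Dᴴ) = 2 − 2Re(a b c̄ d̄)`. [folklore] -/
theorem two_sub_re_trace_plaqWord (A B C D : SU2) :
    (2 : ℝ) - (((A : Matrix (Fin 2) (Fin 2) ℂ) * (B : Matrix (Fin 2) (Fin 2) ℂ) * (C : Matrix (Fin 2) (Fin 2) ℂ)ᴴ * (D : Matrix (Fin 2) (Fin 2) ℂ)ᴴ).trace).re =
      2 - 2 * (su2Quat A * su2Quat B * star (su2Quat C) * star (su2Quat D)).re := by
  rw [← quatMatrix_su2Quat A, ← quatMatrix_su2Quat B, ← quatMatrix_su2Quat C, ← quatMatrix_su2Quat D]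
  simp only [← quatMatrix_star, ← quatMatrix_mul, trace_quatMatrix_re]

omit [NeZero L] in
/-- The temporal insertion in quaternion letters: `Re tr(U·Y·Vᴴ + U·(V·Y′)ᴴ) = 2Re(u(y − y′)v̄)` for pure `y′`. [folklore] -/
theorem re_trace_tb_insertion (U V : SU2) (y : ℍ) {y' : ℍ} (hy' : y'.re = 0) :
    ((((U : Matrix (Fin 2) (Fin 2) ℂ) * quatMatrix y * (V : Matrix (Fin 2) (Fin 2) ℂ)ᴴ +
        (U : Matrix (Fin 2) (Fin 2) ℂ) * ((V : Matrix (Fin 2) (Fin 2) ℂ) * quatMatrix y')ᴴ).trace).re) =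
      2 * (su2Quat U * (y - y') * star (su2Quat V)).re := by
  have hW : (U : Matrix (Fin 2) (Fin 2) ℂ) * quatMatrix y * (V : Matrix (Fin 2) (Fin 2) ℂ)ᴴ +
        (U : Matrix (Fin 2) (Fin 2) ℂ) * ((V : Matrix (Fin 2) (Fin 2) ℂ) * quatMatrix y')ᴴ =
      quatMatrix (su2Quat U * y * star (su2Quat V) + su2Quat U * star (su2Quat V * y')) := by
    simp only [quatMatrix_mul, quatMatrix_add, quatMatrix_star, quatMatrix_su2Quat]
  rw [hW, trace_quatMatrix_re]
  congr 2
  rw [star_mul, star_eq_neg_of_pure hy']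
  noncomm_ring

omit [NeZero L] in
/-- The seam insertion in quaternion letters (slots `(q₁,q₂,q₃,q₄) = (a,d,c,b)`, directions `(A₁,A₂,A₃,A₄) = (y_a,y_d,y_c,y_b)`, `y_b, y_c, y_d` pure):
`Re tr(A Y_a (B C Dᴴ)ᴴ + A (B Y_b C Dᴴ + B C Y_c Dᴴ + B C (D Y_d)ᴴ)ᴴ) = 2Re(q₁A₁q₂q̄₃q̄₄ + q₁q₂A₂q̄₃q̄₄ − q₁q₂A₃q̄₃q̄₄ − q₁q₂q̄₃A₄q̄₄)`. [folklore] -/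
theorem re_trace_seam_insertion (A B C D : SU2) (ya : ℍ) {yb yc yd : ℍ} (hyb : yb.re = 0) (hyc : yc.re = 0) (hyd : yd.re = 0) :
    ((((A : Matrix (Fin 2) (Fin 2) ℂ) * quatMatrix ya * ((B : Matrix (Fin 2) (Fin 2) ℂ) * (C : Matrix (Fin 2) (Fin 2) ℂ) * (D : Matrix (Fin 2) (Fin 2) ℂ)ᴴ)ᴴ +
        (A : Matrix (Fin 2) (Fin 2) ℂ) *
          ((B : Matrix (Fin 2) (Fin 2) ℂ) * quatMatrix yb * (C : Matrix (Fin 2) (Fin 2) ℂ) * (D : Matrix (Fin 2) (Fin 2) ℂ)ᴴ +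
            (B : Matrix (Fin 2) (Fin 2) ℂ) * ((C : Matrix (Fin 2) (Fin 2) ℂ) * quatMatrix yc) * (D : Matrix (Fin 2) (Fin 2) ℂ)ᴴ +
            (B : Matrix (Fin 2) (Fin 2) ℂ) * (C : Matrix (Fin 2) (Fin 2) ℂ) * ((D : Matrix (Fin 2) (Fin 2) ℂ) * quatMatrix yd)ᴴ)ᴴ).trace).re) =
      2 * (su2Quat A * ya * su2Quat D * star (su2Quat C) * star (su2Quat B) +
            su2Quat A * su2Quat D * yd * star (su2Quat C) * star (su2Quat B) -
            su2Quat A * su2Quat D * yc * star (su2Quat C) * star (su2Quat B) -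
            su2Quat A * su2Quat D * star (su2Quat C) * yb * star (su2Quat B)).re := by
  have hW : (A : Matrix (Fin 2) (Fin 2) ℂ) * quatMatrix ya * ((B : Matrix (Fin 2) (Fin 2) ℂ) * (C : Matrix (Fin 2) (Fin 2) ℂ) * (D : Matrix (Fin 2) (Fin 2) ℂ)ᴴ)ᴴ +
        (A : Matrix (Fin 2) (Fin 2) ℂ) *
          ((B : Matrix (Fin 2) (Fin 2) ℂ) * quatMatrix yb * (C : Matrix (Fin 2) (Fin 2) ℂ) * (D : Matrix (Fin 2) (Fin 2) ℂ)ᴴ +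
            (B : Matrix (Fin 2) (Fin 2) ℂ) * ((C : Matrix (Fin 2) (Fin 2) ℂ) * quatMatrix yc) * (D : Matrix (Fin 2) (Fin 2) ℂ)ᴴ +
            (B : Matrix (Fin 2) (Fin 2) ℂ) * (C : Matrix (Fin 2) (Fin 2) ℂ) * ((D : Matrix (Fin 2) (Fin 2) ℂ) * quatMatrix yd)ᴴ)ᴴ =
      quatMatrix (su2Quat A * ya * star (su2Quat B * su2Quat C * star (su2Quat D)) +
        su2Quat A * star (su2Quat B * yb * su2Quat C * star (su2Quat D) + su2Quat B * (su2Quat C * yc) * star (su2Quat D) +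
          su2Quat B * su2Quat C * star (su2Quat D * yd))) := by
    simp only [quatMatrix_mul, quatMatrix_add, quatMatrix_star, quatMatrix_su2Quat]
  rw [hW, trace_quatMatrix_re]
  congr 2
  simp only [star_mul, star_add, star_star, star_neg, neg_neg, star_eq_neg_of_pure hyb, star_eq_neg_of_pure hyc, star_eq_neg_of_pure hyd]
  noncomm_ring

omit [NeZero L] in
/-- The plaquette insertion in quaternion letters (`y₃, y₄` pure):
`Re tr(A Y₁ B Cᴴ Dᴴ + A B Y₂ Cᴴ Dᴴ + A B (C Y₃)ᴴ Dᴴ + A B Cᴴ (D Y₄)ᴴ) = 2Re(q₁A₁q₂q̄₃q̄₄ + q₁q₂A₂q̄₃q̄₄ − q₁q₂A₃q̄₃q̄₄ − q₁q₂q̄₃A₄q̄₄)`. [folklore] -/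
theorem re_trace_plaq_insertion (A B C D : SU2) (y₁ y₂ : ℍ) {y₃ y₄ : ℍ} (hy₃ : y₃.re = 0) (hy₄ : y₄.re = 0) :
    ((((A : Matrix (Fin 2) (Fin 2) ℂ) * quatMatrix y₁ * (B : Matrix (Fin 2) (Fin 2) ℂ) * (C : Matrix (Fin 2) (Fin 2) ℂ)ᴴ * (D : Matrix (Fin 2) (Fin 2) ℂ)ᴴ +
        (A : Matrix (Fin 2) (Fin 2) ℂ) * ((B : Matrix (Fin 2) (Fin 2) ℂ) * quatMatrix y₂) * (C : Matrix (Fin 2) (Fin 2) ℂ)ᴴ * (D : Matrix (Fin 2) (Fin 2) ℂ)ᴴ +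
        (A : Matrix (Fin 2) (Fin 2) ℂ) * (B : Matrix (Fin 2) (Fin 2) ℂ) * ((C : Matrix (Fin 2) (Fin 2) ℂ) * quatMatrix y₃)ᴴ * (D : Matrix (Fin 2) (Fin 2) ℂ)ᴴ +
        (A : Matrix (Fin 2) (Fin 2) ℂ) * (B : Matrix (Fin 2) (Fin 2) ℂ) * (C : Matrix (Fin 2) (Fin 2) ℂ)ᴴ * ((D : Matrix (Fin 2) (Fin 2) ℂ) * quatMatrix y₄)ᴴ).trace).re) =
      2 * (su2Quat A * y₁ * su2Quat B * star (su2Quat C) * star (su2Quat D) +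
            su2Quat A * su2Quat B * y₂ * star (su2Quat C) * star (su2Quat D) -
            su2Quat A * su2Quat B * y₃ * star (su2Quat C) * star (su2Quat D) -
            su2Quat A * su2Quat B * star (su2Quat C) * y₄ * star (su2Quat D)).re := by
  have hW : (A : Matrix (Fin 2) (Fin 2) ℂ) * quatMatrix y₁ * (B : Matrix (Fin 2) (Fin 2) ℂ) * (C : Matrix (Fin 2) (Fin 2) ℂ)ᴴ * (D : Matrix (Fin 2) (Fin 2) ℂ)ᴴ +
        (A : Matrix (Fin 2) (Fin 2) ℂ) * ((B : Matrix (Fin 2) (Fin 2) ℂ) * quatMatrix y₂) * (C : Matrix (Fin 2) (Fin 2) ℂ)ᴴ * (D : Matrix (Fin 2) (Fin 2) ℂ)ᴴ +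
        (A : Matrix (Fin 2) (Fin 2) ℂ) * (B : Matrix (Fin 2) (Fin 2) ℂ) * ((C : Matrix (Fin 2) (Fin 2) ℂ) * quatMatrix y₃)ᴴ * (D : Matrix (Fin 2) (Fin 2) ℂ)ᴴ +
        (A : Matrix (Fin 2) (Fin 2) ℂ) * (B : Matrix (Fin 2) (Fin 2) ℂ) * (C : Matrix (Fin 2) (Fin 2) ℂ)ᴴ * ((D : Matrix (Fin 2) (Fin 2) ℂ) * quatMatrix y₄)ᴴ =
      quatMatrix (su2Quat A * y₁ * su2Quat B * star (su2Quat C) * star (su2Quat D) +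
        su2Quat A * (su2Quat B * y₂) * star (su2Quat C) * star (su2Quat D) +
        su2Quat A * su2Quat B * star (su2Quat C * y₃) * star (su2Quat D) +
        su2Quat A * su2Quat B * star (su2Quat C) * star (su2Quat D * y₄)) := by
    simp only [quatMatrix_mul, quatMatrix_add, quatMatrix_star, quatMatrix_su2Quat]
  rw [hW, trace_quatMatrix_re]
  congr 2
  simp only [star_mul, star_eq_neg_of_pure hy₃, star_eq_neg_of_pure hy₄]
  noncomm_ring

/-! ### Field forms (one direction field `y` on all ring variables, pure) -/

omit [NeZero L] in
/-- Temporal insertion, field form. [folklore] -/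
theorem re_trace_tb_insertion_field {ι : Type*} (y : ι → ℍ) (hy : ∀ v, (y v).re = 0) (U V : SU2) (v v' : ι) :
    ((((U : Matrix (Fin 2) (Fin 2) ℂ) * quatMatrix (y v) * (V : Matrix (Fin 2) (Fin 2) ℂ)ᴴ +
        (U : Matrix (Fin 2) (Fin 2) ℂ) * ((V : Matrix (Fin 2) (Fin 2) ℂ) * quatMatrix (y v'))ᴴ).trace).re) =
      2 * (su2Quat U * (y v - y v') * star (su2Quat V)).re :=
  re_trace_tb_insertion U V (y v) (hy v')

omit [NeZero L] in
/-- Seam insertion, field form. [folklore] -/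
theorem re_trace_seam_insertion_field {ι : Type*} (y : ι → ℍ) (hy : ∀ v, (y v).re = 0) (A B C D : SU2) (va vb vc vd : ι) :
    ((((A : Matrix (Fin 2) (Fin 2) ℂ) * quatMatrix (y va) * ((B : Matrix (Fin 2) (Fin 2) ℂ) * (C : Matrix (Fin 2) (Fin 2) ℂ) * (D : Matrix (Fin 2) (Fin 2) ℂ)ᴴ)ᴴ +
        (A : Matrix (Fin 2) (Fin 2) ℂ) *
          ((B : Matrix (Fin 2) (Fin 2) ℂ) * quatMatrix (y vb) * (C : Matrix (Fin 2) (Fin 2) ℂ) * (D : Matrix (Fin 2) (Fin 2) ℂ)ᴴ +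
            (B : Matrix (Fin 2) (Fin 2) ℂ) * ((C : Matrix (Fin 2) (Fin 2) ℂ) * quatMatrix (y vc)) * (D : Matrix (Fin 2) (Fin 2) ℂ)ᴴ +
            (B : Matrix (Fin 2) (Fin 2) ℂ) * (C : Matrix (Fin 2) (Fin 2) ℂ) * ((D : Matrix (Fin 2) (Fin 2) ℂ) * quatMatrix (y vd))ᴴ)ᴴ).trace).re) =
      2 * (su2Quat A * y va * su2Quat D * star (su2Quat C) * star (su2Quat B) +
            su2Quat A * su2Quat D * y vd * star (su2Quat C) * star (su2Quat B) -
            su2Quat A * su2Quat D * y vc * star (su2Quat C) * star (su2Quat B) -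
            su2Quat A * su2Quat D * star (su2Quat C) * y vb * star (su2Quat B)).re :=
  re_trace_seam_insertion A B C D (y va) (hy vb) (hy vc) (hy vd)

omit [NeZero L] in
/-- Plaquette insertion, field form. [folklore] -/
theorem re_trace_plaq_insertion_field {ι : Type*} (y : ι → ℍ) (hy : ∀ v, (y v).re = 0) (A B C D : SU2) (v₁ v₂ v₃ v₄ : ι) :
    ((((A : Matrix (Fin 2) (Fin 2) ℂ) * quatMatrix (y v₁) * (B : Matrix (Fin 2) (Fin 2) ℂ) * (C : Matrix (Fin 2) (Fin 2) ℂ)ᴴ * (D : Matrix (Fin 2) (Fin 2) ℂ)ᴴ +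
        (A : Matrix (Fin 2) (Fin 2) ℂ) * ((B : Matrix (Fin 2) (Fin 2) ℂ) * quatMatrix (y v₂)) * (C : Matrix (Fin 2) (Fin 2) ℂ)ᴴ * (D : Matrix (Fin 2) (Fin 2) ℂ)ᴴ +
        (A : Matrix (Fin 2) (Fin 2) ℂ) * (B : Matrix (Fin 2) (Fin 2) ℂ) * ((C : Matrix (Fin 2) (Fin 2) ℂ) * quatMatrix (y v₃))ᴴ * (D : Matrix (Fin 2) (Fin 2) ℂ)ᴴ +
        (A : Matrix (Fin 2) (Fin 2) ℂ) * (B : Matrix (Fin 2) (Fin 2) ℂ) * (C : Matrix (Fin 2) (Fin 2) ℂ)ᴴ * ((D : Matrix (Fin 2) (Fin 2) ℂ) * quatMatrix (y v₄))ᴴ).trace).re) =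
      2 * (su2Quat A * y v₁ * su2Quat B * star (su2Quat C) * star (su2Quat D) +
            su2Quat A * su2Quat B * y v₂ * star (su2Quat C) * star (su2Quat D) -
            su2Quat A * su2Quat B * y v₃ * star (su2Quat C) * star (su2Quat D) -
            su2Quat A * su2Quat B * star (su2Quat C) * y v₄ * star (su2Quat D)).re :=
  re_trace_plaq_insertion A B C D (y v₁) (y v₂) (hy v₃) (hy v₄)

/-! ## §2 ★ The deficit as a sum of words -/

/-- ★ **The zero-flux deficit in quaternion letters**: temporal words `2 − 2Re(q_{i,e}·q̄_{i+1,e})`, seam words and plaquette words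
`2 − 2Re(q₁q₂q̄₃q̄₄)` with the slot orders of the file header. [cite: Luscher1983, §2] -/
theorem ringDeficit_eq_quat_sums (P : (Fin (2 * L - 1 + 1) → GaugeConfig 3 L SU2) × (Site 3 L → SU2)) :
    ringDeficit L (fun _ => false) P =
      (∑ i : Fin (2 * L - 1), ∑ e : Edge 3 L, ((2 : ℝ) - 2 * (su2Quat (P.1 i.castSucc e) * star (su2Quat (P.1 i.succ e))).re)) +
      (∑ e : Edge 3 L, ((2 : ℝ) - 2 * (su2Quat (P.1 (Fin.last (2 * L - 1)) e) * su2Quat (P.2 (e.1.shift e.2)) *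
          star (su2Quat (P.1 0 e)) * star (su2Quat (P.2 e.1))).re)) +
      ∑ j : Fin (2 * L - 1 + 1), ∑ p : Plaquette 3 L,
        ((2 : ℝ) - 2 * (su2Quat (P.1 j (p.1, p.2.1.1)) * su2Quat (P.1 j (p.1.shift p.2.1.1, p.2.1.2)) *
          star (su2Quat (P.1 j (p.1.shift p.2.1.2, p.2.1.1))) * star (su2Quat (P.1 j (p.1, p.2.1.2)))).re) := by
  rw [ringDeficit_eq_ringPoly, ringPoly]
  simp only [ringCoord, two_sub_re_trace_tb, two_sub_re_trace_seamWord, two_sub_re_trace_plaqWord]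

/-! ## §3 ★★ The drive along a pure direction field as a sum of words -/

/-- ★★ **The frame derivative of the deficit polynomial along ANY pure direction field, in quaternion letters.**  For `Y v = quatMatrix (y v)` with
`Re(y v) = 0` at every ring variable `v`:  `frameD Y ringPoly (ringCoord P)` is the sum of the temporal drives `−2Re(q_{i,e}(A_{i,e} − A_{i+1,e})q̄_{i+1,e})`,
the seam drives and the plaquette drives `−2Re(q₁A₁q₂q̄₃q̄₄ + q₁q₂A₂q̄₃q̄₄ − q₁q₂A₃q̄₃q̄₄ − q₁q₂q̄₃A₄q̄₄)`, `A_v = y v` — VERBATIM the `D`-letters of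
✓`EulerDefect.temporal_euler_identity` ∕ ✓`EulerDefect.drive_sub_two_eq` (✓`fderiv_ringPoly_apply` read through §1). [cite: arXiv220412737, §2 (2.4) (p. 10)] -/
theorem frameD_ringPoly_eq_quat_sums (P : (Fin (2 * L - 1 + 1) → GaugeConfig 3 L SU2) × (Site 3 L → SU2))
    (Y : ((Fin (2 * L - 1 + 1) × Edge 3 L) ⊕ Site 3 L) → Matrix (Fin 2) (Fin 2) ℂ) (y : ((Fin (2 * L - 1 + 1) × Edge 3 L) ⊕ Site 3 L) → ℍ)
    (hY : ∀ v, Y v = quatMatrix (y v)) (hy : ∀ v, (y v).re = 0) :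
    frameD Y (ringPoly L) (ringCoord L P) =
      (∑ i : Fin (2 * L - 1), ∑ e : Edge 3 L,
        -2 * (su2Quat (P.1 i.castSucc e) * (y (Sum.inl (i.castSucc, e)) - y (Sum.inl (i.succ, e))) * star (su2Quat (P.1 i.succ e))).re) +
      (∑ e : Edge 3 L,
        -2 * (su2Quat (P.1 (Fin.last (2 * L - 1)) e) * y (Sum.inl (Fin.last (2 * L - 1), e)) * su2Quat (P.2 (e.1.shift e.2)) *
                star (su2Quat (P.1 0 e)) * star (su2Quat (P.2 e.1)) +
              su2Quat (P.1 (Fin.last (2 * L - 1)) e) * su2Quat (P.2 (e.1.shift e.2)) * y (Sum.inr (e.1.shift e.2)) *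
                star (su2Quat (P.1 0 e)) * star (su2Quat (P.2 e.1)) -
              su2Quat (P.1 (Fin.last (2 * L - 1)) e) * su2Quat (P.2 (e.1.shift e.2)) * y (Sum.inl (0, e)) *
                star (su2Quat (P.1 0 e)) * star (su2Quat (P.2 e.1)) -
              su2Quat (P.1 (Fin.last (2 * L - 1)) e) * su2Quat (P.2 (e.1.shift e.2)) * star (su2Quat (P.1 0 e)) * y (Sum.inr e.1) *
                star (su2Quat (P.2 e.1))).re) +
      ∑ j : Fin (2 * L - 1 + 1), ∑ p : Plaquette 3 L,
        -2 * (su2Quat (P.1 j (p.1, p.2.1.1)) * y (Sum.inl (j, (p.1, p.2.1.1))) * su2Quat (P.1 j (p.1.shift p.2.1.1, p.2.1.2)) *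
                star (su2Quat (P.1 j (p.1.shift p.2.1.2, p.2.1.1))) * star (su2Quat (P.1 j (p.1, p.2.1.2))) +
              su2Quat (P.1 j (p.1, p.2.1.1)) * su2Quat (P.1 j (p.1.shift p.2.1.1, p.2.1.2)) * y (Sum.inl (j, (p.1.shift p.2.1.1, p.2.1.2))) *
                star (su2Quat (P.1 j (p.1.shift p.2.1.2, p.2.1.1))) * star (su2Quat (P.1 j (p.1, p.2.1.2))) -
              su2Quat (P.1 j (p.1, p.2.1.1)) * su2Quat (P.1 j (p.1.shift p.2.1.1, p.2.1.2)) * y (Sum.inl (j, (p.1.shift p.2.1.2, p.2.1.1))) *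
                star (su2Quat (P.1 j (p.1.shift p.2.1.2, p.2.1.1))) * star (su2Quat (P.1 j (p.1, p.2.1.2))) -
              su2Quat (P.1 j (p.1, p.2.1.1)) * su2Quat (P.1 j (p.1.shift p.2.1.1, p.2.1.2)) * star (su2Quat (P.1 j (p.1.shift p.2.1.2, p.2.1.1))) *
                y (Sum.inl (j, (p.1, p.2.1.2))) * star (su2Quat (P.1 j (p.1, p.2.1.2)))).re := by
  rw [frameD, fderiv_ringPoly_apply]
  simp only [mulTangent, ringCoord, hY, re_trace_tb_insertion_field y hy, re_trace_seam_insertion_field y hy,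
    re_trace_plaq_insertion_field y hy]
  simp only [neg_mul, Finset.sum_neg_distrib, neg_add]

/-! ## §4 ★★ The drive of the explicit central field -/

/-- The slot reading of the explicit central field as a PURE QUATERNION FIELD: `A_v := Im(c̄_v·q_v) + (s_v/2)·Im c_v`
(w2 g52 ✓`centralDir_slot`, in `Quaternion.im` letters). [cite: CosteEtAl1985] -/
theorem centralDir_slot_im {σ : Fin 3 → ℝ} (hσ : ∀ k, σ k = 1 ∨ σ k = -1) {σ₄ : ℝ} (hσ₄ : σ₄ = 1 ∨ σ₄ = -1)
    (P : (Fin (2 * L - 1 + 1) → GaugeConfig 3 L SU2) × (Site 3 L → SU2)) (ht : treeGauge (P.1 0) = 1)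
    (hz : ∀ k : Fin 3, (blockIm L (wrapBlock L k) k P 0) ^ 2 + (blockIm L (wrapBlock L k) k P 1) ^ 2 + (blockIm L (wrapBlock L k) k P 2) ^ 2 ≤ 1 / 2)
    (hz₄ : (seamIm L P 0) ^ 2 + (seamIm L P 1) ^ 2 + (seamIm L P 2) ^ 2 ≤ 1 / 2)
    (v : (Fin (2 * L - 1 + 1) × Edge 3 L) ⊕ Site 3 L) :
    centralDir L σ σ₄ (ringCoord L P) v =
      quatMatrix ((star (slotQuat (centralProj L σ σ₄ P) v) * slotQuat P v).im +
        (slotSign σ σ₄ v / 2) • (slotQuat (centralProj L σ σ₄ P) v).im) := by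
  rw [centralDir_slot hσ hσ₄ P ht hz hz₄ v]
  congr 1
  ext <;> simp

omit [NeZero L] in
/-- The slot directions are pure. [folklore] -/
theorem re_centralSlot_eq_zero (c q : ℍ) (s : ℝ) : ((star c * q).im + (s / 2) • c.im).re = 0 := by
  simp

/-- ★★ **THE DRIVE OF THE EXPLICIT CENTRAL FIELD IN QUATERNION LETTERS.**  On the central region of a slice-`0` comb-gauged ring history
(`|z_k|², |z₄|² ≤ ½`, signs `±1`), the package drive `Σ_va centralCoeff L σ σ₄ va M · frameGrad fixFrameStd M va` (`M = ringCoord P`; ✓`centralDrive_eq_frameD`)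
is the sum of the temporal ∕ seam ∕ plaquette `D`-words of §3 with the directions `A_v = Im(c̄_v q_v) + (s_v/2)·Im c_v`, `q_v = slotQuat P v`,
`c_v = slotQuat (π_C P) v`, `s_v = slotSign σ σ₄ v`. [cite: CosteEtAl1985] [cite: Luscher1983, §2] -/
theorem centralDrive_eq_quat_sums {σ : Fin 3 → ℝ} (hσ : ∀ k, σ k = 1 ∨ σ k = -1) {σ₄ : ℝ} (hσ₄ : σ₄ = 1 ∨ σ₄ = -1)
    (P : (Fin (2 * L - 1 + 1) → GaugeConfig 3 L SU2) × (Site 3 L → SU2)) (ht : treeGauge (P.1 0) = 1)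
    (hz : ∀ k : Fin 3, (blockIm L (wrapBlock L k) k P 0) ^ 2 + (blockIm L (wrapBlock L k) k P 1) ^ 2 + (blockIm L (wrapBlock L k) k P 2) ^ 2 ≤ 1 / 2)
    (hz₄ : (seamIm L P 0) ^ 2 + (seamIm L P 1) ^ 2 + (seamIm L P 2) ^ 2 ≤ 1 / 2) :
    let A : ((Fin (2 * L - 1 + 1) × Edge 3 L) ⊕ Site 3 L) → ℍ := fun v =>
      (star (slotQuat (centralProj L σ σ₄ P) v) * slotQuat P v).im + (slotSign σ σ₄ v / 2) • (slotQuat (centralProj L σ σ₄ P) v).im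
    ∑ va : FixVar L × Fin 3, centralCoeff L σ σ₄ va (ringCoord L P) * frameGrad (fixFrameStd (L := L)) (ringCoord L P) va =
      (∑ i : Fin (2 * L - 1), ∑ e : Edge 3 L,
        -2 * (su2Quat (P.1 i.castSucc e) * (A (Sum.inl (i.castSucc, e)) - A (Sum.inl (i.succ, e))) * star (su2Quat (P.1 i.succ e))).re) +
      (∑ e : Edge 3 L,
        -2 * (su2Quat (P.1 (Fin.last (2 * L - 1)) e) * A (Sum.inl (Fin.last (2 * L - 1), e)) * su2Quat (P.2 (e.1.shift e.2)) *
                star (su2Quat (P.1 0 e)) * star (su2Quat (P.2 e.1)) +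
              su2Quat (P.1 (Fin.last (2 * L - 1)) e) * su2Quat (P.2 (e.1.shift e.2)) * A (Sum.inr (e.1.shift e.2)) *
                star (su2Quat (P.1 0 e)) * star (su2Quat (P.2 e.1)) -
              su2Quat (P.1 (Fin.last (2 * L - 1)) e) * su2Quat (P.2 (e.1.shift e.2)) * A (Sum.inl (0, e)) *
                star (su2Quat (P.1 0 e)) * star (su2Quat (P.2 e.1)) -
              su2Quat (P.1 (Fin.last (2 * L - 1)) e) * su2Quat (P.2 (e.1.shift e.2)) * star (su2Quat (P.1 0 e)) * A (Sum.inr e.1) *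
                star (su2Quat (P.2 e.1))).re) +
      ∑ j : Fin (2 * L - 1 + 1), ∑ p : Plaquette 3 L,
        -2 * (su2Quat (P.1 j (p.1, p.2.1.1)) * A (Sum.inl (j, (p.1, p.2.1.1))) * su2Quat (P.1 j (p.1.shift p.2.1.1, p.2.1.2)) *
                star (su2Quat (P.1 j (p.1.shift p.2.1.2, p.2.1.1))) * star (su2Quat (P.1 j (p.1, p.2.1.2))) +
              su2Quat (P.1 j (p.1, p.2.1.1)) * su2Quat (P.1 j (p.1.shift p.2.1.1, p.2.1.2)) * A (Sum.inl (j, (p.1.shift p.2.1.1, p.2.1.2))) *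
                star (su2Quat (P.1 j (p.1.shift p.2.1.2, p.2.1.1))) * star (su2Quat (P.1 j (p.1, p.2.1.2))) -
              su2Quat (P.1 j (p.1, p.2.1.1)) * su2Quat (P.1 j (p.1.shift p.2.1.1, p.2.1.2)) * A (Sum.inl (j, (p.1.shift p.2.1.2, p.2.1.1))) *
                star (su2Quat (P.1 j (p.1.shift p.2.1.2, p.2.1.1))) * star (su2Quat (P.1 j (p.1, p.2.1.2))) -
              su2Quat (P.1 j (p.1, p.2.1.1)) * su2Quat (P.1 j (p.1.shift p.2.1.1, p.2.1.2)) * star (su2Quat (P.1 j (p.1.shift p.2.1.2, p.2.1.1))) *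
                A (Sum.inl (j, (p.1, p.2.1.2))) * star (su2Quat (P.1 j (p.1, p.2.1.2)))).re := by
  intro A
  rw [centralDrive_eq_frameD]
  exact frameD_ringPoly_eq_quat_sums P (centralDir L σ σ₄ (ringCoord L P)) A (centralDir_slot_im hσ hσ₄ P ht hz hz₄)
    (fun v => re_centralSlot_eq_zero _ _ _)

end Summit.QuantumFields.YangMills.Theorems.VirialFluxGap.DriveReading

end
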